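import Literature.MathematicalPhysics.QuantumLattice.GibbsEnergyEntropyBalanceMatrixCuts
import HarnessLib

/-!
# A finite (grid) certificate for the one-parameter semidefinite condition of matrix
# energy–entropy-balance cuts

Topic `Literature/MathematicalPhysics/QuantumLattice`; reader-side complement of
`GibbsEnergyEntropyBalanceMatrixCuts.lean`, which reduces the validity of a matrix energy–entropy-balance
row `(Λ_A, Λ_B, Λ_C)` for Gibbs states to

  `Λ_A + e^{−x} Λ_B + x Λ_C ⪰ 0` for every real `x`.

For the dual rows of the LMI-relaxed matrix EEB (`Λ_B ⪰ 0`, `Λ_C ⪰ 0`, as for the tangent planes of the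
concave, positively homogeneous trace functionals `tr(W P_r(B, A))` used by the producers) this
ONE-PARAMETER condition follows from FINITELY MANY semidefinite tests of rational matrices — a monotone
sandwich on a grid `x₀ ≤ x₁ ≤ … ≤ x_N` with rational under-estimates `q_k ≤ e^{−x_k}`:

* on `[x_k, x_{k+1}]`: `Λ_A + e^{−x}Λ_B + xΛ_C ⪰ Λ_A + q_{k+1}Λ_B + x_kΛ_C` (`e^{−x}` decreasing, `Λ_B ⪰ 0`;
  `x ≥ x_k`, `Λ_C ⪰ 0`);
* for `x ≤ x₀`: `e^{−x} ≥ e^{−x₀}(1 + x₀ − x) ≥ q₀(1 + x₀ − x)`, so it suffices that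
  `Λ_A + q₀Λ_B + x₀Λ_C ⪰ 0` and `q₀Λ_B − Λ_C ⪰ 0`;
* for `x ≥ x_N`: `Λ_A + x_NΛ_C ⪰ 0` suffices.

`posSemidef_oneParam_of_grid` packages this: the listed PSD tests (each checkable in exact arithmetic,
`Literature.Analysis.ValidatedNumerics.PSDCert.ldltCheck`) imply the one-parameter condition, hence
(`sum_exp_mul_re_expect_matrixCut_nonneg` & co.) the validity of the row for every Gibbs eigen-mixture
and every thermal torus limit. Everything is PROVED; no definition, no named fact.

References: Fawzi–Fawzi–Scalet 2024 §3.2 Thm. 3.4 (matrix EEB) [FawziFawziScalet2024]; Kull et al. 2024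
§5.3 (exactly checked, rounded certificates) [KullEtAl2024].
-/

noncomputable section

namespace Literature.MathematicalPhysics.QuantumLattice

open Matrix Finset
open scoped ComplexOrder BigOperators

section Grid

variable {m : Type*}

/-- PSD bookkeeping: `X ⪰ 0`, `P ⪰ 0`, `Q ⪰ 0`, `0 ≤ r`, `0 ≤ s` ⇒ `X + r•P + s•Q ⪰ 0`. [folklore] -/
private theorem posSemidef_add_smul_add_smul {X P Q : Matrix m m ℂ} (hX : X.PosSemidef) (hP : P.PosSemidef)
    (hQ : Q.PosSemidef) {r s : ℝ} (hr : 0 ≤ r) (hs : 0 ≤ s) :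
    (X + ((r : ℝ) : ℂ) • P + ((s : ℝ) : ℂ) • Q).PosSemidef :=
  (hX.add (hP.smul (Complex.zero_le_real.2 hr))).add (hQ.smul (Complex.zero_le_real.2 hs))

/-- The tangent bound of the convex function `e^{−x}` at `x₀`: `e^{−x₀}(1 + x₀ − x) ≤ e^{−x}`. [folklore] -/
private theorem exp_neg_mul_one_add_sub_le (x₀ x : ℝ) : Real.exp (-x₀) * (1 + x₀ - x) ≤ Real.exp (-x) := by
  have h := Real.add_one_le_exp (x₀ - x)
  have hx : Real.exp (-x) = Real.exp (-x₀) * Real.exp (x₀ - x) := by rw [← Real.exp_add]; ring_nf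
  rw [hx]
  exact mul_le_mul_of_nonneg_left (by linarith) (Real.exp_pos _).le

/-- **Grid certificate for the one-parameter semidefinite condition.** Let `Λ_B ⪰ 0`, `Λ_C ⪰ 0`, a grid
`x : Fin (N+1) → ℝ` with `x_k ≤ x_{k+1}`, numbers `q_k ≤ e^{−x_k}`, and suppose
(cells) `Λ_A + q_{k+1}Λ_B + x_kΛ_C ⪰ 0` for every `k < N`, (lower tail) `Λ_A + q₀Λ_B + x₀Λ_C ⪰ 0` and
`q₀Λ_B − Λ_C ⪰ 0`, (upper tail) `Λ_A + x_NΛ_C ⪰ 0`. Then `Λ_A + e^{−x}Λ_B + xΛ_C ⪰ 0` for EVERY real `x` —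
the hypothesis of `sum_exp_mul_re_expect_matrixCut_nonneg` /
`IsTorusLimitOfMixture.re_expect_matrixCut_nonneg_of_sectorGibbs`, obtained from finitely many exact
semidefinite tests. [cite: FawziFawziScalet2024, Thm. 3.4] -/
theorem posSemidef_oneParam_of_grid {N : ℕ} {ΛA ΛB ΛC : Matrix m m ℂ} (hB : ΛB.PosSemidef) (hC : ΛC.PosSemidef)
    (x q : Fin (N + 1) → ℝ) (hmono : ∀ k : Fin N, x k.castSucc ≤ x k.succ)
    (hq : ∀ k, q k ≤ Real.exp (-x k))
    (hcell : ∀ k : Fin N, (ΛA + ((q k.succ : ℝ) : ℂ) • ΛB + ((x k.castSucc : ℝ) : ℂ) • ΛC).PosSemidef)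
    (hlo : (ΛA + ((q 0 : ℝ) : ℂ) • ΛB + ((x 0 : ℝ) : ℂ) • ΛC).PosSemidef)
    (hlo' : (((q 0 : ℝ) : ℂ) • ΛB - ΛC).PosSemidef)
    (hhi : (ΛA + ((x (Fin.last N) : ℝ) : ℂ) • ΛC).PosSemidef) (y : ℝ) :
    (ΛA + ((Real.exp (-y) : ℝ) : ℂ) • ΛB + ((y : ℝ) : ℂ) • ΛC).PosSemidef := by
  -- monotonicity of the grid between arbitrary indices
  have hmono' : Monotone x := by
    refine Fin.monotone_iff_le_succ.2 fun k => hmono k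
  rcases le_or_gt y (x 0) with hy0 | hy0
  · -- lower tail: `e^{-y} ≥ q₀ (1 + x₀ - y)`
    have h1 : q 0 * (1 + x 0 - y) ≤ Real.exp (-y) := by
      have hfac : 0 ≤ 1 + x 0 - y := by linarith
      exact (mul_le_mul_of_nonneg_right (hq 0) hfac).trans (exp_neg_mul_one_add_sub_le (x 0) y)
    have key : ΛA + ((Real.exp (-y) : ℝ) : ℂ) • ΛB + ((y : ℝ) : ℂ) • ΛC =
        (ΛA + ((q 0 : ℝ) : ℂ) • ΛB + ((x 0 : ℝ) : ℂ) • ΛC) +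
          ((Real.exp (-y) - q 0 * (1 + x 0 - y) : ℝ) : ℂ) • ΛB +
          ((x 0 - y : ℝ) : ℂ) • (((q 0 : ℝ) : ℂ) • ΛB - ΛC) := by
      push_cast
      module
    rw [key]
    exact posSemidef_add_smul_add_smul hlo hB hlo' (by linarith) (by linarith)
  rcases le_or_gt (x (Fin.last N)) y with hyN | hyN
  · -- upper tail
    have key : ΛA + ((Real.exp (-y) : ℝ) : ℂ) • ΛB + ((y : ℝ) : ℂ) • ΛC =
        (ΛA + ((x (Fin.last N) : ℝ) : ℂ) • ΛC) + ((Real.exp (-y) : ℝ) : ℂ) • ΛB +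
          ((y - x (Fin.last N) : ℝ) : ℂ) • ΛC := by
      push_cast
      module
    rw [key]
    exact posSemidef_add_smul_add_smul hhi hB hC (Real.exp_pos _).le (by linarith)
  · -- a cell `[x_k, x_{k+1}]` containing `y`: `k` = the largest index with `x_k ≤ y`
    have hne : (Finset.univ.filter fun i : Fin (N + 1) => x i ≤ y).Nonempty :=
      ⟨0, Finset.mem_filter.2 ⟨Finset.mem_univ _, hy0.le⟩⟩
    obtain ⟨k, hk, hkmax⟩ := Finset.exists_max_image _ (fun i : Fin (N + 1) => i) hne
    have hxk : x k ≤ y := (Finset.mem_filter.1 hk).2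
    have hklt : (k : ℕ) < N := by
      by_contra hge
      have hkN : k = Fin.last N := Fin.ext (le_antisymm (Nat.lt_succ_iff.1 k.2) (not_lt.1 hge))
      rw [hkN] at hxk
      linarith
    set k' : Fin N := ⟨k, hklt⟩ with hk'
    have hkc : k'.castSucc = k := Fin.ext rfl
    have hsucc : y < x k'.succ := by
      by_contra hge
      have hmem : k'.succ ∈ Finset.univ.filter fun i : Fin (N + 1) => x i ≤ y :=
        Finset.mem_filter.2 ⟨Finset.mem_univ _, not_lt.1 hge⟩
      have h := hkmax _ hmem
      have : (k'.succ : ℕ) ≤ (k : ℕ) := h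
      simp [Fin.succ, hk'] at this
    have hexp : q k'.succ ≤ Real.exp (-y) :=
      (hq k'.succ).trans (Real.exp_le_exp.2 (by linarith))
    have key : ΛA + ((Real.exp (-y) : ℝ) : ℂ) • ΛB + ((y : ℝ) : ℂ) • ΛC =
        (ΛA + ((q k'.succ : ℝ) : ℂ) • ΛB + ((x k'.castSucc : ℝ) : ℂ) • ΛC) +
          ((Real.exp (-y) - q k'.succ : ℝ) : ℂ) • ΛB + ((y - x k'.castSucc : ℝ) : ℂ) • ΛC := by
      push_cast
      module
    rw [key]
    refine posSemidef_add_smul_add_smul (hcell k') hB hC (by linarith) ?_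
    rw [hkc]
    linarith

end Grid

end Literature.MathematicalPhysics.QuantumLattice

end
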